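/-
Copyright: the b2b-balaban T⁴-continuum CRUX team, row NE7b OWNER lineage `t4-ne7b-p1` (gen 136). Project licence.
-/
import Summits.QuantumFields.BalabanUV.T4Continuum.Spine.NE7b.SupConvexStepIntegrated
import Summits.QuantumFields.BalabanUV.T4Continuum.Spine.NE7b.SupJointConvexity

/-!
# THE LOWER SECOND-ORDER LETTER PASSES THROUGH THE GAUSSIAN FLUCTUATION INTEGRAL FOR ANY BLOCK-LOCAL POTENTIAL — (β1)'s SECOND BRICK
# (Prékopa–Leindler ∕ Brascamp–Lieb, the mechanism of (317)∕(318) WITHOUT single-site structure).  (i) ABSTRACT: if three actions on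
# `ℝ^σ` satisfy the joint secant letter `S_s((1−s)x + sy) ≤ (1−s)S₀(x) + sS₁(y)`, then `−log∫e^{−S_s} ≤ (1−s)(−log∫e^{−S₀}) + s(−log∫e^{−S₁})`;
# (ii) for a BLOCK potential `U : ℝ^σ → ℝ` with the lower letter in secant form (constant `λ`: `U((1−s)a+sb) − ½λs(1−s)|a−b|² ≤ (1−s)U(a)+sU(b)`)
# and a precision `M = Mᵀ` with floor `m`, `2λ ≤ m`, the joint action `S_ψ(z) = ½⟨z,Mz⟩ + U(z+ψ) + λ|ψ|²` satisfies the joint secant letter;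
# hence (iii) `W̃(ψ) = −log∫e^{−½⟨z,Mz⟩−U(z+ψ)}dz + λ|ψ|²` is convex along segments, and (iv) wherever `−log∫e^{−½⟨z,Mz⟩−U(z+ψ)}dz` is
# differentiable, the LOWER FIRST-ORDER LETTER `W(ψ₀) + DW(ψ₀)(ψ₁−ψ₀) − λ|ψ₁−ψ₀|² ≤ W(ψ₁)` holds — the lower half of the two-sided class
# for the NEXT potential of a BLOCK-local input (row NE7b, node U5c; (116) `prekopaLeindler_fintype`, (317) BY NAME; [cite: BrascampLieb1976,
# Thm 4.3]; [folklore])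

Cell `pub-balaban`, sub-cell `t4`, spine estimate NE7b (`T4WeightBudget.RelWeightBound`; the cell's OWN estimate — NOT PRINTED in
[Bałaban 1983–89], NOT PROVED).  Crux-route work under `Spine/NE7b/` by the row OWNER (`t4-ne7b-p1` gen 136, file (398)) under FREEZE
(0)'s crux-prover clause, on this gen's SCOPING-d8 (β1); NOTHING of Bałaban's is named as a Lean object, valued or asserted; no
`T4Continuum/Support` leaf typed; no `def`, no notation; zero `sorry`.  Imports (BY NAME): the convex column's (116) `…SupConvexStepIntegrated`
(`prekopaLeindler_fintype`), the OWNER's (317) `…SupJointConvexity` (`quadForm_secant`, `firstOrder_of_secant_hasFDerivAt'`); Mathlib's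
`ofReal_integral_eq_lintegral_ofReal`, `integral_exp_pos`, `HasFDerivAt.sum`.

WHAT IS PROVED ([folklore]; Lebesgue measure on `σ → ℝ`, `σ` a `Fintype`):
* §1 **`neg_log_integral_secant`** (ABSTRACT Prékopa–Leindler transfer: measurable `S₀, S₁, S_s` with the joint secant letter, `e^{−S_k}`
  integrable, `0 < s < 1` ⟹ `0 < ∫e^{−S_s}` and `−log∫e^{−S_s} ≤ (1−s)(−log∫e^{−S₀}) + s(−log∫e^{−S₁})`);
* §2 `shift_secant_univ`, **`block_jointAction_secant`** (the joint secant letter of `½⟨z,Mz⟩ + U(z+ψ) + λΣψ²` from `U`'s secant lower letter,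
  the floor of `M` and the budget `2λ ≤ m`);
* §3 THE END **`block_neg_log_secant`** (`W̃` is convex along the segment), `hasFDerivAt_sq_sum` (`D(λΣψ²)(ψ₀) = 2λΣψ₀δ`),
  **`block_lower_letter_of_hasFDerivAt`** (`HasFDerivAt (−log Z) L ψ₀ ⟹ −log Z(ψ₀) + L(ψ₁−ψ₀) − λΣ(ψ₁−ψ₀)² ≤ −log Z(ψ₁)`); §4 toy.

HONEST (what this is NOT).  The differentiability of `−log Z` for a block potential (dominated differentiation, (313)'s twin) is a
HYPOTHESIS of the first-order form; the Gaussian is written as the Lebesgue weight `e^{−½⟨z,Mz⟩}` ((318)'s dictionary to `N(0,M⁻¹)` is the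
successor's line); integrability letters are hypotheses; scalar skeleton ((A3), NC-NE7b-α UNRULED); nothing of Bałaban's asserted.  BY-NAME EFFECT
ON THE WALL: NONE.  NE7b NOT PRINTED ∕ NOT PROVED; spine PROVED 0∕9; rung (B)+1 — the programme's measures remain FINITE-torus statements; NOT the
mass gap, NOT Clay.  HONEST DEPENDENCY: continuum YM on T⁴ ⇐ BetaPertH ∧ nine spine estimates (0∕9 proved); BetaPertH ⇐ (D1) ∧ (D4) ∧ CAP+tail;
G-an2-4 gates asym, D1 and NE2∕3∕4.
-/

set_option autoImplicit false

noncomputable section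

namespace Summit.QuantumFields.BalabanUV.T4Continuum.NE7b.SupBlockLowerLetterTransfer

open MeasureTheory Finset Real Matrix
open scoped BigOperators ENNReal
open SupConvexStepIntegrated (prekopaLeindler_fintype)
open SupJointConvexity (quadForm_secant firstOrder_of_secant_hasFDerivAt')

variable {σ : Type} [Fintype σ]

/-! ## §1. The abstract Prékopa–Leindler transfer -/

/-- **JOINT SECANT LETTER ⟹ SECANT LETTER OF `−log∫e^{−S}`** (Prékopa–Leindler on `ℝ^σ`).  For measurable `S₀, S₁, S_s : ℝ^σ → ℝ` with
`S_s((1−s)x + sy) ≤ (1−s)S₀(x) + sS₁(y)` for all `x, y`, `e^{−S₀}, e^{−S₁}, e^{−S_s}` integrable and `0 < s < 1`: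
`0 < ∫e^{−S_s}` and `−log∫e^{−S_s} ≤ (1−s)(−log∫e^{−S₀}) + s(−log∫e^{−S₁})`. [folklore] -/
theorem neg_log_integral_secant {S₀ S₁ Ss : (σ → ℝ) → ℝ} (hm₀ : Measurable S₀) (hm₁ : Measurable S₁) (hms : Measurable Ss) {s : ℝ}
    (hs0 : 0 < s) (hs1 : s < 1) (hsec : ∀ x y : σ → ℝ, Ss ((1 - s) • x + s • y) ≤ (1 - s) * S₀ x + s * S₁ y)
    (hI₀ : Integrable (fun z : σ → ℝ => Real.exp (-S₀ z))) (hI₁ : Integrable (fun z : σ → ℝ => Real.exp (-S₁ z)))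
    (hIs : Integrable (fun z : σ → ℝ => Real.exp (-Ss z))) :
    0 < ∫ z : σ → ℝ, Real.exp (-Ss z) ∧
      -Real.log (∫ z : σ → ℝ, Real.exp (-Ss z)) ≤
        (1 - s) * -Real.log (∫ z : σ → ℝ, Real.exp (-S₀ z)) + s * -Real.log (∫ z : σ → ℝ, Real.exp (-S₁ z)) := by
  have hZ₀ : 0 < ∫ z : σ → ℝ, Real.exp (-S₀ z) := integral_exp_pos hI₀
  have hZ₁ : 0 < ∫ z : σ → ℝ, Real.exp (-S₁ z) := integral_exp_pos hI₁
  have hZs0 : 0 ≤ ∫ z : σ → ℝ, Real.exp (-Ss z) := integral_nonneg fun z => (Real.exp_pos _).le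
  -- Prékopa–Leindler on `ℝ^σ`
  have hf : Measurable fun z : σ → ℝ => ENNReal.ofReal (Real.exp (-S₀ z)) := (measurable_exp.comp hm₀.neg).ennreal_ofReal
  have hg : Measurable fun z : σ → ℝ => ENNReal.ofReal (Real.exp (-S₁ z)) := (measurable_exp.comp hm₁.neg).ennreal_ofReal
  have hh : Measurable fun z : σ → ℝ => ENNReal.ofReal (Real.exp (-Ss z)) := (measurable_exp.comp hms.neg).ennreal_ofReal
  have hPL := prekopaLeindler_fintype hs0 hs1 hf hg hh (fun x y => by
      rw [ENNReal.ofReal_rpow_of_nonneg (exp_pos _).le (by linarith), ENNReal.ofReal_rpow_of_nonneg (exp_pos _).le hs0.le,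
        ← ENNReal.ofReal_mul (rpow_nonneg (exp_pos _).le _), ← exp_mul, ← exp_mul, ← exp_add]
      refine ENNReal.ofReal_le_ofReal (exp_le_exp.2 ?_)
      have key := hsec x y
      nlinarith [key])
  rw [← ofReal_integral_eq_lintegral_ofReal hI₀ (ae_of_all _ fun z => (exp_pos _).le),
    ← ofReal_integral_eq_lintegral_ofReal hI₁ (ae_of_all _ fun z => (exp_pos _).le),
    ← ofReal_integral_eq_lintegral_ofReal hIs (ae_of_all _ fun z => (exp_pos _).le),
    ENNReal.ofReal_rpow_of_nonneg hZ₀.le (by linarith), ENNReal.ofReal_rpow_of_nonneg hZ₁.le hs0.le,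
    ← ENNReal.ofReal_mul (rpow_nonneg hZ₀.le _), ENNReal.ofReal_le_ofReal_iff hZs0] at hPL
  have hprod : 0 < (∫ z : σ → ℝ, Real.exp (-S₀ z)) ^ (1 - s) * (∫ z : σ → ℝ, Real.exp (-S₁ z)) ^ s :=
    mul_pos (rpow_pos_of_pos hZ₀ _) (rpow_pos_of_pos hZ₁ _)
  have hZs : 0 < ∫ z : σ → ℝ, Real.exp (-Ss z) := lt_of_lt_of_le hprod hPL
  refine ⟨hZs, ?_⟩
  have hlog := log_le_log hprod hPL
  rw [log_mul (rpow_pos_of_pos hZ₀ _).ne' (rpow_pos_of_pos hZ₁ _).ne', log_rpow hZ₀, log_rpow hZ₁] at hlog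
  linarith

/-! ## §2. The joint secant letter of a block potential plus the Gaussian weight -/

/-- The shift term over all sites: `(1−s)Σψ₀² + sΣψ₁² − Σψ_s² = s(1−s)Σ(ψ₀−ψ₁)²`. [folklore] -/
theorem shift_secant_univ (ψ₀ ψ₁ : σ → ℝ) (s : ℝ) :
    (1 - s) * ∑ i, ψ₀ i ^ 2 + s * ∑ i, ψ₁ i ^ 2 - ∑ i, ((1 - s) * ψ₀ i + s * ψ₁ i) ^ 2 = s * (1 - s) * ∑ i, (ψ₀ i - ψ₁ i) ^ 2 := by
  simp only [mul_sum, ← sum_sub_distrib, ← sum_add_distrib]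
  refine sum_congr rfl fun i _ => ?_
  ring

/-- **THE JOINT SECANT LETTER OF A BLOCK POTENTIAL.**  `Mᵀ = M` with floor `m·Σz² ≤ ⟨z,Mz⟩`; `U : ℝ^σ → ℝ` with the secant lower letter of
constant `λ ≥ 0` at parameter `s ∈ [0,1]` (`U((1−s)a+sb) − ½λs(1−s)Σ(a−b)² ≤ (1−s)U(a) + sU(b)` for all `a, b`); `2λ ≤ m` ⟹ for all
`x, y, ψ₀, ψ₁`, with `S_ψ(z) = ½⟨z,Mz⟩ + U(z+ψ) + λΣψ²`:  `S_{(1−s)ψ₀+sψ₁}((1−s)x+sy) ≤ (1−s)S_{ψ₀}(x) + sS_{ψ₁}(y)`. [folklore] -/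
theorem block_jointAction_secant {M : Matrix σ σ ℝ} (hM : Mᵀ = M) {m : ℝ} (hfl : ∀ z : σ → ℝ, m * ∑ i, z i ^ 2 ≤ z ⬝ᵥ (M *ᵥ z))
    (U : (σ → ℝ) → ℝ) {lam s : ℝ} (hlam : 0 ≤ lam) (hs0 : 0 ≤ s) (hs1 : s ≤ 1)
    (hUsec : ∀ a b : σ → ℝ, U ((1 - s) • a + s • b) - lam / 2 * (s * (1 - s)) * ∑ i, (a i - b i) ^ 2 ≤ (1 - s) * U a + s * U b)
    (hm : 2 * lam ≤ m) (x y ψ₀ ψ₁ : σ → ℝ) :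
    1 / 2 * (((1 - s) • x + s • y) ⬝ᵥ (M *ᵥ ((1 - s) • x + s • y))) + U (((1 - s) • x + s • y) + ((1 - s) • ψ₀ + s • ψ₁)) +
        lam * ∑ i, ((1 - s) • ψ₀ + s • ψ₁) i ^ 2 ≤
      (1 - s) * (1 / 2 * (x ⬝ᵥ (M *ᵥ x)) + U (x + ψ₀) + lam * ∑ i, ψ₀ i ^ 2) +
        s * (1 / 2 * (y ⬝ᵥ (M *ᵥ y)) + U (y + ψ₁) + lam * ∑ i, ψ₁ i ^ 2) := by
  have hs1' : 0 ≤ 1 - s := sub_nonneg.2 hs1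
  have hss : 0 ≤ s * (1 - s) := mul_nonneg hs0 hs1'
  -- (i) the quadratic form with its floor
  have hQ := quadForm_secant hM hfl x y hs0 hs1
  -- (ii) the potential, at the shifted arguments
  have hU := hUsec (x + ψ₀) (y + ψ₁)
  have e1 : (1 - s) • (x + ψ₀) + s • (y + ψ₁) = ((1 - s) • x + s • y) + ((1 - s) • ψ₀ + s • ψ₁) := by
    rw [smul_add, smul_add]; abel
  rw [e1] at hU
  -- (iii) the shift
  have hS := shift_secant_univ ψ₀ ψ₁ s
  have eψ : ∑ i, ((1 - s) • ψ₀ + s • ψ₁) i ^ 2 = ∑ i, ((1 - s) * ψ₀ i + s * ψ₁ i) ^ 2 :=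
    sum_congr rfl fun i _ => by simp only [Pi.add_apply, Pi.smul_apply, smul_eq_mul]
  rw [eψ]
  -- (iv) the budget `½λΣ(a−b)² ≤ λΣ(x−y)² + λΣ(ψ₀−ψ₁)²`, `λ ≤ ½m`
  have hab : ∑ i, ((x + ψ₀) i - (y + ψ₁) i) ^ 2 ≤ 2 * ∑ i, (x i - y i) ^ 2 + 2 * ∑ i, (ψ₀ i - ψ₁ i) ^ 2 := by
    rw [mul_sum, mul_sum, ← sum_add_distrib]
    refine sum_le_sum fun i _ => ?_
    simp only [Pi.add_apply]
    nlinarith [sq_nonneg ((x i - y i) - (ψ₀ i - ψ₁ i))]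
  have h0 : 0 ≤ ∑ i, (ψ₀ i - ψ₁ i) ^ 2 := sum_nonneg fun i _ => sq_nonneg _
  have h1 : 0 ≤ ∑ i, (x i - y i) ^ 2 := sum_nonneg fun i _ => sq_nonneg _
  nlinarith [hQ, hU, hS, mul_le_mul_of_nonneg_left hab (by positivity : 0 ≤ lam / 2 * (s * (1 - s))),
    mul_le_mul_of_nonneg_left hm (mul_nonneg hss h1)]

/-! ## §3. THE END: the marginal is secant-convex; the lower first-order letter -/

/-- The joint action is measurable in `z` (for measurable `U`). [folklore] -/
theorem measurable_blockAction (M : Matrix σ σ ℝ) {U : (σ → ℝ) → ℝ} (hU : Measurable U) (lam : ℝ) (ψ : σ → ℝ) :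
    Measurable fun z : σ → ℝ => 1 / 2 * (z ⬝ᵥ (M *ᵥ z)) + U (z + ψ) + lam * ∑ i, ψ i ^ 2 := by
  refine ((Measurable.const_mul ?_ _).add (hU.comp (measurable_id.add_const ψ))).add_const _
  exact Continuous.measurable (by
    have h : Continuous fun z : σ → ℝ => z := continuous_id
    exact h.dotProduct (continuous_const.matrix_mulVec h))

/-- **THE MARGINAL IS CONVEX ALONG SEGMENTS.**  Under §2's hypotheses, `U` measurable and the three weights
`e^{−(½⟨z,Mz⟩ + U(z+ψ) + λΣψ²)}` integrable (`ψ ∈ {ψ₀, ψ₁, ψ_s}`), for `0 < s < 1`, with `W̃(ψ) = −log∫e^{−½⟨z,Mz⟩−U(z+ψ)−λΣψ²}dz`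
(`= −log Z(ψ) + λΣψ²`):  `W̃(ψ_s) ≤ (1−s)W̃(ψ₀) + sW̃(ψ₁)`, `ψ_s = (1−s)ψ₀ + sψ₁`. [cite: BrascampLieb1976, Thm 4.3] -/
theorem block_neg_log_secant {M : Matrix σ σ ℝ} (hM : Mᵀ = M) {m : ℝ} (hfl : ∀ z : σ → ℝ, m * ∑ i, z i ^ 2 ≤ z ⬝ᵥ (M *ᵥ z))
    {U : (σ → ℝ) → ℝ} (hUm : Measurable U) {lam s : ℝ} (hlam : 0 ≤ lam) (hs0 : 0 < s) (hs1 : s < 1)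
    (hUsec : ∀ a b : σ → ℝ, U ((1 - s) • a + s • b) - lam / 2 * (s * (1 - s)) * ∑ i, (a i - b i) ^ 2 ≤ (1 - s) * U a + s * U b)
    (hm : 2 * lam ≤ m) (ψ₀ ψ₁ : σ → ℝ)
    (hI : ∀ ψ : σ → ℝ, Integrable (fun z : σ → ℝ => Real.exp (-(1 / 2 * (z ⬝ᵥ (M *ᵥ z)) + U (z + ψ) + lam * ∑ i, ψ i ^ 2)))) :
    0 < ∫ z : σ → ℝ, Real.exp (-(1 / 2 * (z ⬝ᵥ (M *ᵥ z)) + U (z + ((1 - s) • ψ₀ + s • ψ₁)) +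
        lam * ∑ i, ((1 - s) • ψ₀ + s • ψ₁) i ^ 2)) ∧
      -Real.log (∫ z : σ → ℝ, Real.exp (-(1 / 2 * (z ⬝ᵥ (M *ᵥ z)) + U (z + ((1 - s) • ψ₀ + s • ψ₁)) +
          lam * ∑ i, ((1 - s) • ψ₀ + s • ψ₁) i ^ 2))) ≤
        (1 - s) * -Real.log (∫ z : σ → ℝ, Real.exp (-(1 / 2 * (z ⬝ᵥ (M *ᵥ z)) + U (z + ψ₀) + lam * ∑ i, ψ₀ i ^ 2))) +
          s * -Real.log (∫ z : σ → ℝ, Real.exp (-(1 / 2 * (z ⬝ᵥ (M *ᵥ z)) + U (z + ψ₁) + lam * ∑ i, ψ₁ i ^ 2))) :=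
  neg_log_integral_secant (measurable_blockAction M hUm lam ψ₀) (measurable_blockAction M hUm lam ψ₁)
    (measurable_blockAction M hUm lam ((1 - s) • ψ₀ + s • ψ₁)) hs0 hs1
    (fun x y => block_jointAction_secant hM hfl U hlam hs0.le hs1.le hUsec hm x y ψ₀ ψ₁) (hI ψ₀) (hI ψ₁) (hI _)

/-- The derivative of the shift `ψ ↦ λΣψ²` on `σ → ℝ`. [folklore] -/
theorem hasFDerivAt_sq_sum (lam : ℝ) (ψ₀ : σ → ℝ) :
    HasFDerivAt (fun ψ : σ → ℝ => lam * ∑ i, ψ i ^ 2)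
      (lam • ∑ i, (2 * ψ₀ i) • ContinuousLinearMap.proj (R := ℝ) (φ := fun _ : σ => ℝ) i) ψ₀ := by
  have h : ∀ i : σ, HasFDerivAt (fun ψ : σ → ℝ => ψ i ^ 2) ((2 * ψ₀ i) • ContinuousLinearMap.proj (R := ℝ) (φ := fun _ : σ => ℝ) i) ψ₀ :=
    fun i => by
      have h1 : HasFDerivAt (fun ψ : σ → ℝ => ψ i) (ContinuousLinearMap.proj (R := ℝ) (φ := fun _ : σ => ℝ) i) ψ₀ := hasFDerivAt_apply i ψ₀
      have h2 := h1.pow 2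
      simpa using h2
  have hsum := (HasFDerivAt.sum (u := Finset.univ) fun i (_ : i ∈ Finset.univ) => h i).const_mul lam
  have e : (fun ψ : σ → ℝ => lam * ∑ i, ψ i ^ 2) = fun y : σ → ℝ => lam * (∑ i, fun ψ : σ → ℝ => ψ i ^ 2) y := by
    funext y; simp only [Finset.sum_apply]
  rw [e]
  exact hsum

/-- **THE LOWER FIRST-ORDER LETTER OF THE NEXT POTENTIAL FOR A BLOCK-LOCAL INPUT**, given differentiability at the base point: under
`block_neg_log_secant`'s hypotheses for every `s ∈ (0,1)` along the segment `ψ₀ → ψ₁`, and `HasFDerivAt (−log Z) L ψ₀` for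
`Z(ψ) = ∫e^{−½⟨z,Mz⟩−U(z+ψ)}dz`:  `−log Z(ψ₀) + L(ψ₁−ψ₀) − λΣ(ψ₁−ψ₀)² ≤ −log Z(ψ₁)`. [folklore] -/
theorem block_lower_letter_of_hasFDerivAt {M : Matrix σ σ ℝ} (hM : Mᵀ = M) {m : ℝ}
    (hfl : ∀ z : σ → ℝ, m * ∑ i, z i ^ 2 ≤ z ⬝ᵥ (M *ᵥ z)) {U : (σ → ℝ) → ℝ} (hUm : Measurable U) {lam : ℝ} (hlam : 0 ≤ lam)
    (hUsec : ∀ s : ℝ, 0 ≤ s → s ≤ 1 → ∀ a b : σ → ℝ,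
      U ((1 - s) • a + s • b) - lam / 2 * (s * (1 - s)) * ∑ i, (a i - b i) ^ 2 ≤ (1 - s) * U a + s * U b)
    (hm : 2 * lam ≤ m) (ψ₀ ψ₁ : σ → ℝ)
    (hI : ∀ ψ : σ → ℝ, Integrable (fun z : σ → ℝ => Real.exp (-(1 / 2 * (z ⬝ᵥ (M *ᵥ z)) + U (z + ψ)))))
    {L : (σ → ℝ) →L[ℝ] ℝ}
    (hd : HasFDerivAt (fun ψ : σ → ℝ => -Real.log (∫ z : σ → ℝ, Real.exp (-(1 / 2 * (z ⬝ᵥ (M *ᵥ z)) + U (z + ψ))))) L ψ₀) :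
    -Real.log (∫ z : σ → ℝ, Real.exp (-(1 / 2 * (z ⬝ᵥ (M *ᵥ z)) + U (z + ψ₀)))) + L (ψ₁ - ψ₀) - lam * ∑ i, (ψ₁ i - ψ₀ i) ^ 2 ≤
      -Real.log (∫ z : σ → ℝ, Real.exp (-(1 / 2 * (z ⬝ᵥ (M *ᵥ z)) + U (z + ψ₁)))) := by
  -- the integrals with the constant `e^{−λΣψ²}` pulled in and out
  have hsplit : ∀ ψ : σ → ℝ, ∫ z : σ → ℝ, Real.exp (-(1 / 2 * (z ⬝ᵥ (M *ᵥ z)) + U (z + ψ) + lam * ∑ i, ψ i ^ 2)) =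
      Real.exp (-(lam * ∑ i, ψ i ^ 2)) * ∫ z : σ → ℝ, Real.exp (-(1 / 2 * (z ⬝ᵥ (M *ᵥ z)) + U (z + ψ))) := fun ψ => by
    rw [← integral_const_mul]
    refine integral_congr_ae (ae_of_all _ fun z => ?_)
    dsimp only
    rw [← Real.exp_add]; congr 1; ring
  have hI' : ∀ ψ : σ → ℝ, Integrable (fun z : σ → ℝ => Real.exp (-(1 / 2 * (z ⬝ᵥ (M *ᵥ z)) + U (z + ψ) + lam * ∑ i, ψ i ^ 2))) :=
    fun ψ => by
      have h := (hI ψ).const_mul (Real.exp (-(lam * ∑ i, ψ i ^ 2)))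
      refine h.congr (ae_of_all _ fun z => ?_)
      simp only
      rw [← Real.exp_add]; congr 1; ring
  have hZ : ∀ ψ : σ → ℝ, 0 < ∫ z : σ → ℝ, Real.exp (-(1 / 2 * (z ⬝ᵥ (M *ᵥ z)) + U (z + ψ))) := fun ψ => integral_exp_pos (hI ψ)
  -- `W̃ = −log Z + λΣψ²` and its secant letter
  have hWt : ∀ ψ : σ → ℝ, -Real.log (∫ z : σ → ℝ, Real.exp (-(1 / 2 * (z ⬝ᵥ (M *ᵥ z)) + U (z + ψ) + lam * ∑ i, ψ i ^ 2))) =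
      -Real.log (∫ z : σ → ℝ, Real.exp (-(1 / 2 * (z ⬝ᵥ (M *ᵥ z)) + U (z + ψ)))) + lam * ∑ i, ψ i ^ 2 := fun ψ => by
    rw [hsplit ψ, Real.log_mul (Real.exp_pos _).ne' (hZ ψ).ne', Real.log_exp]; ring
  have hsec : ∀ s : ℝ, 0 < s → s < 1 →
      (-Real.log (∫ z : σ → ℝ, Real.exp (-(1 / 2 * (z ⬝ᵥ (M *ᵥ z)) + U (z + (ψ₀ + s • (ψ₁ - ψ₀)))))) +
          lam * ∑ i, (ψ₀ + s • (ψ₁ - ψ₀)) i ^ 2) + 0 / 2 * s * (1 - s) * 0 ≤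
        (1 - s) * (-Real.log (∫ z : σ → ℝ, Real.exp (-(1 / 2 * (z ⬝ᵥ (M *ᵥ z)) + U (z + ψ₀)))) + lam * ∑ i, ψ₀ i ^ 2) +
          s * (-Real.log (∫ z : σ → ℝ, Real.exp (-(1 / 2 * (z ⬝ᵥ (M *ᵥ z)) + U (z + ψ₁)))) + lam * ∑ i, ψ₁ i ^ 2) :=
    fun s hs0 hs1 => by
      have h := (block_neg_log_secant hM hfl hUm hlam hs0 hs1 (hUsec s hs0.le hs1.le) hm ψ₀ ψ₁ hI').2
      rw [hWt, hWt, hWt] at h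
      have e : ψ₀ + s • (ψ₁ - ψ₀) = (1 - s) • ψ₀ + s • ψ₁ := by
        rw [smul_sub, sub_smul, one_smul]; abel
      rw [e]
      linarith
  -- differentiability of `W̃` at `ψ₀`
  have hdt := hd.add (hasFDerivAt_sq_sum lam ψ₀)
  have key := firstOrder_of_secant_hasFDerivAt' (μ := 0) (R := 0) hdt hsec
  -- unfold the shift derivative and the squares
  have happ : (lam • ∑ i, (2 * ψ₀ i) • ContinuousLinearMap.proj (R := ℝ) (φ := fun _ : σ => ℝ) i) (ψ₁ - ψ₀) =
      lam * ∑ i, 2 * ψ₀ i * (ψ₁ i - ψ₀ i) := by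
    simp [ContinuousLinearMap.proj_apply, smul_eq_mul]
  rw [_root_.add_apply, happ] at key
  simp only [Pi.add_apply] at key
  have hsq : ∑ i, ψ₁ i ^ 2 = ∑ i, ψ₀ i ^ 2 + ∑ i, 2 * ψ₀ i * (ψ₁ i - ψ₀ i) + ∑ i, (ψ₁ i - ψ₀ i) ^ 2 := by
    rw [← sum_add_distrib, ← sum_add_distrib]
    exact sum_congr rfl fun i _ => by ring
  rw [hsq, mul_add, mul_add] at key
  linarith [key]

/-! ## §4. Toy -/

/-- Toy (§2): the shift identity at `s = 0`. -/
example (ψ₀ ψ₁ : σ → ℝ) :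
    (1 - 0) * ∑ i, ψ₀ i ^ 2 + 0 * ∑ i, ψ₁ i ^ 2 - ∑ i, ((1 - 0) * ψ₀ i + 0 * ψ₁ i) ^ 2 = 0 * (1 - 0) * ∑ i, (ψ₀ i - ψ₁ i) ^ 2 :=
  shift_secant_univ ψ₀ ψ₁ 0

end Summit.QuantumFields.BalabanUV.T4Continuum.NE7b.SupBlockLowerLetterTransfer
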